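import Summits.AtomisticToContinuum.Crystallization.Theorems.ExcessDecayLiouvilleComparisonBound

/-!
# Route `ExcessDecayLiouville`: the energy of the Dirichlet correction (nonlinear half, V)

Harmonic-replacement architecture for item `ExcessDecay` (stmt-AtomisticToContinuum-9334), nonlinear half.
Solving the comparison inequality of `ExcessDecayLiouvilleComparisonBound` for `nnForm w`:

* `nnForm_correction_le` : `nnForm w ≤ 2(a² + b²)/κ²` with
  `a = (‖f‖_{ℓ²(FW)} + 2ΛV F₈(L) (32ρ'³)^{1/2}) (400ρ'/189 + 2)`, `b = 4·10⁶ Λ NN[ṽ; c₀, ρ'+10L+20]^{1/2}`.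

All `[folklore]`; helper lemmas, nothing here closes an item.
-/

noncomputable section

namespace Summit.AtomisticToContinuum.Crystallization.Theorems.ExcessDecayLiouville

open scoped BigOperators Topology InnerProductSpace RealInnerProductSpace Classical
open Literature.MathematicalPhysics.StatisticalMechanics
open Summit.AtomisticToContinuum.Crystallization.Theorems.PhononStabilityNegative

-- Local notation: the force-constant map `K(e)w = h(|e|²)w + 2⟪e,w⟫h′(|e|²)e`.
local notation3 "𝕂[" e "] " w:max =>
  (-((‖e‖ ^ 2)⁻¹) ^ 7 + ((‖e‖ ^ 2)⁻¹) ^ 4) • w + (2 * ⟪e, w⟫ * (7 * ((‖e‖ ^ 2)⁻¹) ^ 8 - 4 * ((‖e‖ ^ 2)⁻¹) ^ 5)) • e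

section

variable {t : Fin 2 → (EuclideanSpace ℝ (Fin 3))} {A : (EuclideanSpace ℝ (Fin 3)) →L[ℝ] (EuclideanSpace ℝ (Fin 3))}
  {κ : ℝ}

variable (hA : Adm₀ A) (hI : Inner₀ t A)

set_option quotPrecheck false in
-- Local notation: the operator row `(L v)(p)`.
local notation "𝕃" v:max " @ " p:max =>
  tsum (fun q : Sites₀ t A => (if ((p : Sites₀ t A) : EuclideanSpace ℝ (Fin 3)) ≠ q then
    𝕂[((p : Sites₀ t A) : EuclideanSpace ℝ (Fin 3)) - q] (v ((p : Sites₀ t A) : EuclideanSpace ℝ (Fin 3)) - v q) else 0))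
set_option quotPrecheck false in
-- Local notation: the finite near-neighbour form on the ball of radius `X` about `c`.
local notation "NN[" v ", " c ", " X "]" =>
  (∑ p ∈ (finite_sites_dist_le (t := t) (A := A) hA hI c X).toFinset,
    ∑ q ∈ (finite_sites_dist_le (t := t) (A := A) hA hI c X).toFinset,
      (if p ≠ q ∧ dist p q ≤ 11 / 10 then ‖v p - v q‖ ^ 2 else (0 : ℝ)))

/-! ## The bound of the correction energy -/

/-- **Energy of the Dirichlet correction**: rows `(L w)(p) = f p + Σ_{q≠p} Φ p q` on the sites `FW` carrying
`supp w` (`FW ⊆ SR`, all in `B_{ρ'}(c₀)`, `ρ' ≥ 1`), `Φ` antisymmetric with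
`‖Φ p q‖ ≤ Λ|p−q|⁻⁸‖ṽ p − ṽ q‖`, `‖ṽ p − ṽ q‖ ≤ V` on `SR`, `L ≥ 1`: then `nnForm w ≤ 2(a² + b²)/κ²` with
`a = (‖f‖_{ℓ²(FW)} + 2ΛV F₈(L) (32ρ'³)^{1/2}) (400ρ'/189 + 2)`, `b = 4·10⁶ Λ NN[ṽ; c₀, ρ'+10L+20]^{1/2}`.
[folklore] -/
theorem nnForm_correction_le (hκ0 : 0 < κ)
    (hκ : ∀ v : (EuclideanSpace ℝ (Fin 3)) → (EuclideanSpace ℝ (Fin 3)), (Function.support v).Finite →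
      Function.support v ⊆ Sites₀ t A → κ * nnForm t A v ≤ ∑' p : Sites₀ t A, ⟪𝕃 v @ p, v p⟫)
    {w : (EuclideanSpace ℝ (Fin 3)) → (EuclideanSpace ℝ (Fin 3))} (hw : (Function.support w).Finite)
    (FW SR : Finset (EuclideanSpace ℝ (Fin 3))) (hFW : ∀ x, w x ≠ 0 → x ∈ FW) (hFWSR : FW ⊆ SR)
    (hSRS : ∀ x ∈ SR, x ∈ Sites₀ t A) (f : (EuclideanSpace ℝ (Fin 3)) → (EuclideanSpace ℝ (Fin 3)))
    (Φ : (EuclideanSpace ℝ (Fin 3)) → (EuclideanSpace ℝ (Fin 3)) → (EuclideanSpace ℝ (Fin 3)))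
    (hrow : ∀ p : Sites₀ t A, (p : EuclideanSpace ℝ (Fin 3)) ∈ FW →
      𝕃 w @ p = f p + ∑ q ∈ SR.erase p, Φ p q)
    (hanti : ∀ p ∈ SR, ∀ q ∈ SR, Φ q p = -Φ p q)
    {c₀ : EuclideanSpace ℝ (Fin 3)} {ρ' : ℝ} (hρ' : 1 ≤ ρ') (hFWball : ∀ x ∈ FW, dist x c₀ ≤ ρ')
    {vt : (EuclideanSpace ℝ (Fin 3)) → (EuclideanSpace ℝ (Fin 3))} {Λ V L : ℝ} (hΛ : 0 ≤ Λ) (hV : 0 ≤ V) (hL : 1 ≤ L)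
    (hΦ : ∀ p ∈ SR, ∀ q ∈ SR, p ≠ q → ‖Φ p q‖ ≤ Λ * (dist p q)⁻¹ ^ 8 * ‖vt p - vt q‖)
    (hVb : ∀ p ∈ SR, ∀ q ∈ SR, ‖vt p - vt q‖ ≤ V) :
    nnForm t A w ≤ 2 * (((Real.sqrt (∑ x ∈ FW, ‖f x‖ ^ 2) +
        2 * Λ * V * (1024 / ((23 / 25 : ℝ) ^ 3 * L ^ 5)) * Real.sqrt (32 * ρ' ^ 3)) * (400 * ρ' / 189 + 2)) ^ 2 +
      (4000000 * Λ * Real.sqrt (NN[vt, c₀, ρ' + 10 * L + 20])) ^ 2) / κ ^ 2 := by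
  classical
  have hE := comparison_energy_abs hκ hw FW SR hFW hFWSR hSRS f Φ hrow hanti
  have hwB : ∀ x, w x ≠ 0 → x ∈ SR ∧ dist x c₀ ≤ ρ' := fun x hx => ⟨hFWSR (hFW x hx), hFWball x (hFW x hx)⟩
  have hΨ := flux_pairing_le hA hI hw SR hSRS hwB Φ hanti hΛ hV hL hΦ hVb
  -- norms of w
  set N := nnForm t A w with hNdef
  have hN0 : 0 ≤ N := nnForm_nonneg t A w
  set P : ℝ := 400 * ρ' / 189 + 2 with hP
  have hP0 : 0 ≤ P := by rw [hP]; positivity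
  have hwS : Function.support w ⊆ Sites₀ t A := fun x hx => hSRS x (hFWSR (hFW x hx))
  have hsupp : Function.support w ⊆ Metric.closedBall c₀ ρ' := fun x hx => by
    rw [Metric.mem_closedBall]; exact hFWball x (hFW x hx)
  have hPoinc := tsum_norm_sq_le_mul_nnForm hA hI hw (by linarith) hsupp
  -- Σ_{FW} ‖w‖² ≤ Σ' ‖w‖² ≤ P² N
  have hFWmem : ∀ x ∈ FW, x ∈ Sites₀ t A := fun x hx => hSRS x (hFWSR hx)
  have hl2 : ∑ x ∈ FW, ‖w x‖ ^ 2 ≤ P ^ 2 * N := by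
    refine le_trans ?_ hPoinc
    rw [← Finset.sum_subtype_of_mem (f := fun x => ‖w x‖ ^ 2) hFWmem]
    exact (summable_normSq_of_finite (t := t) (A := A) hw).sum_le_tsum _ fun _ _ => sq_nonneg _
  have hsqrt_l2 : Real.sqrt (∑ x ∈ FW, ‖w x‖ ^ 2) ≤ P * Real.sqrt N := by
    calc Real.sqrt (∑ x ∈ FW, ‖w x‖ ^ 2) ≤ Real.sqrt (P ^ 2 * N) := Real.sqrt_le_sqrt hl2
      _ = P * Real.sqrt N := by rw [Real.sqrt_mul (sq_nonneg _), Real.sqrt_sq hP0]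
  -- Σ_{FW} ‖f‖‖w‖ ≤ ‖f‖₂ ‖w‖₂
  have hfw : ∑ x ∈ FW, ‖f x‖ * ‖w x‖ ≤ Real.sqrt (∑ x ∈ FW, ‖f x‖ ^ 2) * Real.sqrt (∑ x ∈ FW, ‖w x‖ ^ 2) := by
    have h := Finset.sum_mul_sq_le_sq_mul_sq FW (fun x => ‖f x‖) (fun x => ‖w x‖)
    have h0 : 0 ≤ ∑ x ∈ FW, ‖f x‖ * ‖w x‖ := Finset.sum_nonneg fun _ _ => by positivity
    rw [← Real.sqrt_mul (Finset.sum_nonneg fun _ _ => sq_nonneg _), ← Real.sqrt_sq h0]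
    exact Real.sqrt_le_sqrt h
  -- Σ_{SR} ‖w‖ = Σ_{FW} ‖w‖ ≤ √card · ‖w‖₂ ≤ √(32ρ'³) P √N
  have hcard : (FW.card : ℝ) ≤ 32 * ρ' ^ 3 := card_ball_sites_le hA hI c₀ hρ' FW fun x hx => ⟨hFWmem x hx, hFWball x hx⟩
  have hl1 : ∑ x ∈ SR, ‖w x‖ ≤ Real.sqrt (32 * ρ' ^ 3) * (P * Real.sqrt N) := by
    rw [← Finset.sum_subset hFWSR (f := fun x => ‖w x‖) (fun x _ hx => by
      have : w x = 0 := by by_contra h; exact hx (hFW x h)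
      rw [this, norm_zero])]
    calc ∑ x ∈ FW, ‖w x‖ ≤ Real.sqrt FW.card * Real.sqrt (∑ x ∈ FW, ‖w x‖ ^ 2) := sum_norm_le_sqrt_card_mul
      _ ≤ Real.sqrt (32 * ρ' ^ 3) * (P * Real.sqrt N) :=
          mul_le_mul (Real.sqrt_le_sqrt hcard) hsqrt_l2 (Real.sqrt_nonneg _) (Real.sqrt_nonneg _)
  -- assemble κ X² ≤ a X + b X
  set X := Real.sqrt N with hX
  have hX0 : 0 ≤ X := Real.sqrt_nonneg _
  have hXN : X ^ 2 = N := Real.sq_sqrt hN0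
  set F8 : ℝ := 1024 / ((23 / 25 : ℝ) ^ 3 * L ^ 5) with hF8
  have hF80 : 0 ≤ F8 := by rw [hF8]; positivity
  set a : ℝ := (Real.sqrt (∑ x ∈ FW, ‖f x‖ ^ 2) + 2 * Λ * V * F8 * Real.sqrt (32 * ρ' ^ 3)) * P with ha
  set b : ℝ := 4000000 * Λ * Real.sqrt (NN[vt, c₀, ρ' + 10 * L + 20]) with hb
  have ha0 : 0 ≤ a := by rw [ha]; positivity
  have hb0 : 0 ≤ b := by rw [hb]; positivity
  have hkey : κ * X ^ 2 ≤ a * X + b * X := by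
    rw [hXN]
    have h1 : ∑ x ∈ FW, ‖f x‖ * ‖w x‖ ≤ Real.sqrt (∑ x ∈ FW, ‖f x‖ ^ 2) * (P * X) :=
      hfw.trans (mul_le_mul_of_nonneg_left hsqrt_l2 (Real.sqrt_nonneg _))
    have h2 : (1 / 2) * ∑ p ∈ SR, ∑ q ∈ SR.erase p, ‖Φ p q‖ * ‖w p - w q‖ ≤
        Λ * (4000000 * Real.sqrt (NN[vt, c₀, ρ' + 10 * L + 20]) * X + 2 * V * F8 * (Real.sqrt (32 * ρ' ^ 3) * (P * X))) := by
      have := hΨ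
      have h3 : 2 * V * F8 * ∑ x ∈ SR, ‖w x‖ ≤ 2 * V * F8 * (Real.sqrt (32 * ρ' ^ 3) * (P * X)) :=
        mul_le_mul_of_nonneg_left hl1 (by positivity)
      nlinarith [mul_le_mul_of_nonneg_left h3 hΛ]
    have h4 : κ * N ≤ Real.sqrt (∑ x ∈ FW, ‖f x‖ ^ 2) * (P * X) +
        Λ * (4000000 * Real.sqrt (NN[vt, c₀, ρ' + 10 * L + 20]) * X + 2 * V * F8 * (Real.sqrt (32 * ρ' ^ 3) * (P * X))) :=
      by linarith
    have h5 : Real.sqrt (∑ x ∈ FW, ‖f x‖ ^ 2) * (P * X) +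
        Λ * (4000000 * Real.sqrt (NN[vt, c₀, ρ' + 10 * L + 20]) * X + 2 * V * F8 * (Real.sqrt (32 * ρ' ^ 3) * (P * X))) =
        a * X + b * X := by rw [ha, hb]; ring
    linarith
  have := (sqrt_energy_le hκ0 hX0 ha0 hb0 hkey).2
  rw [hXN] at this
  exact this

end

end Summit.AtomisticToContinuum.Crystallization.Theorems.ExcessDecayLiouville

end
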